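import Mathlib

/-!
# PercRepro — THE ARITHMETIC OF THE UNIFORM THEOREM BELOW THE THRESHOLD (p3, gen 33; part 24)

The cell theorems of TriangleCapSevenTen … TriangleCapRowPlusSeven close every cell `(k, k − 1 + t)` with
`t + 3 ≤ k` below the threshold `2k + t ≤ t² + 6` by the same six numbers of `cell_count` and a case analysis
on the maximum degree `d`, the maximum off-degree `δ` and the matching pairs `T`.  This module is that case
analysis ONCE, for every `t ≥ 5`: the key inequality `2T + 4(g − 1)(t + 2 − d) ≤ Y` (`g = k − 1 − d`) from the
defect sum `Y ≥ 4(m′ − δ)(δ − 2)` and the split sum `Y ≥ (t − 1)T + (|R| − T)(m′ + 1 − 2δ)`, in the leaves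
`δ ≤ 3` (split sum), `(2m′ − d)(m′ + 1 − 2δ) ≥ 4(g − 1)(t + 2 − d)` (split sum), and otherwise the defect sum,
which is `(g + t − 2 − 2a)² + Γ` with `Γ = 4at − 4a² − 2a − 2t − 5 − 2P − P²` at `P = m′ + 1 − 2δ`; the
finitely many `(t, a, P)` with `Γ < 0` are enumerated (`t ≤ 10`).  Axioms: standard.
-/

namespace PercRepro

namespace TriangleCap

namespace C047

namespace Uniform

/-- `2·C(d, 2) + d = d²`. -/
theorem two_mul_choose_two_add' (d : ℕ) : 2 * d.choose 2 + d = d * d := by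
  rw [Nat.choose_two_right, Nat.mul_div_cancel' (Nat.even_mul_pred_self d).two_dvd]
  cases d with
  | zero => rfl
  | succ d => rw [Nat.add_sub_cancel]; ring

/-- The degree cap below the threshold: with `k = t + 3 + j` and `m = k − 1 + t`, every degree `≤ 4` gives
`3m ≤ C(k − 2, 2) + C(t + 1, 2) + t + 1` for `t ≥ 5`. -/
theorem cap_arith (t j : ℕ) (ht : 5 ≤ t) :
    3 * (2 * t + 2 + j) ≤ (t + 1 + j).choose 2 + (t + 1).choose 2 + t + 1 := by
  have h1 := two_mul_choose_two_add' (t + 1 + j)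
  have h2 := two_mul_choose_two_add' (t + 1)
  obtain ⟨s, rfl⟩ : ∃ s, t = s + 5 := ⟨t - 5, by omega⟩
  nlinarith [h1, h2, Nat.zero_le (s * s), Nat.zero_le (s * j), Nat.zero_le (j * j)]

/-- The dominating vertex (`g = 0`): `T = 2t ≤ d`, `T² ≤ 2Y + 2T` and the threshold `2(d + 1) + t ≤ t² + 6`
give `4d ≤ Y + 8`. -/
theorem dom_arith (t d T Y : ℕ) (hT : T = 2 * t) (hTT : T * T ≤ 2 * Y + 2 * T)
    (hk : 2 * (d + 1) + t ≤ t * t + 6) : 4 * d ≤ Y + 8 := by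
  subst hT
  nlinarith [hTT, hk]

/-- The split sum alone: `Y ≥ (t − 1)T ≥ 2T` for `t ≥ 3`. -/
theorem two_mul_le_of_split (t T Y Z : ℕ) (ht : 3 ≤ t) (h : T * (t - 1) + Z ≤ Y) : 2 * T ≤ Y := by
  have : T * 2 ≤ T * (t - 1) := Nat.mul_le_mul_left T (by omega)
  omega

/-- Leaf A (`δ ≤ 3`, `g ≥ 2`): the split sum with `m′ + 1 − 2δ ≥ m′ − 5` gives the key inequality. -/
theorem leafA_arith (t a g δ T Y : ℕ) (ht : 5 ≤ t) (hat : a + 3 ≤ t) (hg : 2 ≤ g)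
    (hT : T + a ≤ t + 2) (hδ : δ ≤ 3)
    (hSS : T * (t - 1) + (2 * (g + t) - T) * (g + t + 1 - 2 * δ) ≤ Y) :
    2 * T + 4 * ((g - 1) * a) ≤ Y := by
  have h1 : (2 * (g + t) - T) * (g + t - 5) ≤ (2 * (g + t) - T) * (g + t + 1 - 2 * δ) :=
    Nat.mul_le_mul_left _ (by omega)
  have h2 : (g + t) * (g + t - 5) ≤ (2 * (g + t) - T) * (g + t - 5) :=
    Nat.mul_le_mul_right _ (by omega)
  have h3 : T * 2 ≤ T * (t - 1) := Nat.mul_le_mul_left T (by omega)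
  obtain ⟨h, rfl⟩ : ∃ h, g = h + 2 := ⟨g - 2, by omega⟩
  obtain ⟨s, rfl⟩ : ∃ s, t = s + 5 := ⟨t - 5, by omega⟩
  obtain ⟨a', ha'⟩ : ∃ a', s + 2 = a + a' := ⟨s + 2 - a, by omega⟩
  have e1 : h + 2 + (s + 5) - 5 = h + s + 2 := by omega
  rw [e1] at h1 h2
  have e2 : h + 2 - 1 = h + 1 := by omega
  rw [e2]
  -- `(h + s + 7)(h + s + 2) ≥ 4(h + 1)a` with `a ≤ s + 2`: `(h − s)² + h + 5s + 6 ≥ 0`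
  have h4 : 4 * ((h + 1) * a) ≤ (h + 2 + (s + 5)) * (h + s + 2) := by
    rcases le_total h s with hhs | hhs
    · obtain ⟨u, rfl⟩ : ∃ u, s = h + u := ⟨s - h, by omega⟩
      nlinarith [ha', Nat.zero_le (u * u), Nat.zero_le (h * u), Nat.zero_le (h * h)]
    · obtain ⟨u, rfl⟩ : ∃ u, h = s + u := ⟨h - s, by omega⟩
      nlinarith [ha', Nat.zero_le (u * u), Nat.zero_le (s * u), Nat.zero_le (s * s)]
  omega

/-- Leaf B (`(2m′ − d)·P ≥ 4(g − 1)a`): the split sum with `T ≤ d` gives the key inequality. -/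
theorem leafB_arith (t a g δ T Y : ℕ) (ht : 5 ≤ t) (hT : T + a ≤ t + 2)
    (hS1 : 4 * ((g - 1) * a) ≤ (2 * (g + t) - (t + 2 - a)) * (g + t + 1 - 2 * δ))
    (hSS : T * (t - 1) + (2 * (g + t) - T) * (g + t + 1 - 2 * δ) ≤ Y) :
    2 * T + 4 * ((g - 1) * a) ≤ Y := by
  have h1 : (2 * (g + t) - (t + 2 - a)) * (g + t + 1 - 2 * δ) ≤
      (2 * (g + t) - T) * (g + t + 1 - 2 * δ) := Nat.mul_le_mul_right _ (by omega)
  have h3 : T * 2 ≤ T * (t - 1) := Nat.mul_le_mul_left T (by omega)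
  omega

/-- Leaf C1 (`δ ≥ 4`, `2δ ≥ m′ + 1`, `g ≥ 2`): the defect sum gives `4(m′ − δ)(δ − 2) ≥ 2d + 4(g − 1)a`.
Offsets: `δ = 4 + x`, `d = δ + y`, `a = 1 + a'`, `g = 2 + h`, `t = d + a − 2`. -/
theorem leafC1_arith (x y a' h : ℕ) (ht : 2 ≤ x + y + a') (hP : h + y + a' ≤ x + 2) :
    2 * (4 + x + y) + 4 * ((1 + h) * (1 + a')) ≤ 4 * ((1 + h + y + a') * (2 + x)) := by
  have p1 : a' * (h + y + a') ≤ a' * (x + 2) := Nat.mul_le_mul_left _ hP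
  have p2 : h * (h + y + a') ≤ h * (x + 2) := Nat.mul_le_mul_left _ hP
  nlinarith [p1, p2, Nat.zero_le (x * y), Nat.zero_le (x * h), Nat.zero_le (y * a'), Nat.zero_le (y * h),
    Nat.zero_le (a' * a'), Nat.zero_le (h * h), Nat.zero_le (a' * (x + y + a' - 2))]

/-- Leaf C2, the finite part: when `Γ = 4at − 4a² − 2a − 2t − 5 − 2P − P² < 0` with `1 ≤ P ≤ 2a − 1`,
`a ≤ t − 3`, `2a ≤ t + 1 + P` and the feasibility `4a + 1 + (t + a − 2)P ≤ (4a − 2P)(t + 3 − 2a + P)`, then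
`t ≤ 10`. -/
theorem leafC2_t_le_ten (t a P : ℤ) (ht : 5 ≤ t) (ha : 1 ≤ a) (hP : 1 ≤ P) (hat : a + 3 ≤ t)
    (hw : P + 1 ≤ 2 * a) (hH : 2 * a ≤ t + 1 + P)
    (hFz : 4 * a + 1 + (t + a - 2) * P ≤ (4 * a - 2 * P) * (t + 3 - 2 * a + P))
    (hΓ : 4 * a * t - 4 * a * a - 2 * a - 2 * t - 5 - 2 * P - P * P < 0) : t ≤ 10 := by
  have hs : (0 : ℤ) ≤ t - 5 := by linarith
  have ha' : (0 : ℤ) ≤ a - 1 := by linarith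
  have hp' : (0 : ℤ) ≤ P - 1 := by linarith
  have hA3 : (0 : ℤ) ≤ t - 3 - a := by linarith
  have hW : (0 : ℤ) ≤ 2 * a - 1 - P := by linarith
  have hH3 : (0 : ℤ) ≤ t + 1 + P - 2 * a := by linarith
  have hF : (0 : ℤ) ≤ (4 * a - 2 * P) * (t + 3 - 2 * a + P) - (4 * a + 1 + (t + a - 2) * P) := by linarith
  have hG : (0 : ℤ) ≤ -(4 * a * t - 4 * a * a - 2 * a - 2 * t - 5 - 2 * P - P * P) - 1 := by linarith
  nlinarith [mul_nonneg hs hA3, mul_nonneg hs hF, mul_nonneg hs hG, mul_nonneg ha' hA3, mul_nonneg ha' hF,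
    mul_nonneg hp' hA3, mul_nonneg hp' hF, mul_nonneg hp' hG, mul_nonneg hA3 hG,
    mul_nonneg (mul_nonneg hs ha') hW, mul_nonneg (mul_nonneg hs hW) hW, mul_nonneg (mul_nonneg ha' hA3) hH3,
    mul_nonneg (mul_nonneg ha' hW) hW, mul_nonneg (mul_nonneg hp' hA3) hA3, mul_nonneg (mul_nonneg hp' hA3) hW,
    mul_nonneg (mul_nonneg hp' hW) hW]

/-- Leaf C2 (`δ ≥ 4`, `P = m′ + 1 − 2δ ≥ 1`, `g ≥ 2`, and `(2m′ − d)P < 4(g − 1)a`): the defect sum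
`4(m′ − δ)(δ − 2) = (m′ − 1 + P)(m′ − 3 − P)` is `≥ 2d + 4(g − 1)a`.  In integers, `m′ = g + t`, `d = t + 2 − a`. -/
theorem leafC2_arith (t a g P : ℤ) (ht : 5 ≤ t) (ha : 1 ≤ a) (hat : a + 3 ≤ t) (hg : 2 ≤ g) (hP : 1 ≤ P)
    (hP7 : P ≤ g + t - 7) (hgd : g ≤ t + 3 - 2 * a + P)
    (hQ : (2 * g + t + a - 2) * P + 1 ≤ 4 * (g - 1) * a) :
    2 * (t + 2 - a) + 4 * (g - 1) * a ≤ (g + t - 1 + P) * (g + t - 3 - P) := by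
  -- `P ≤ 2a − 1`
  have hw : P + 1 ≤ 2 * a := by
    by_contra hcon
    push Not at hcon
    have h1 : (2 * g + t + a - 2) * (2 * a) ≤ (2 * g + t + a - 2) * P :=
      mul_le_mul_of_nonneg_left (by linarith) (by linarith)
    nlinarith [h1, hQ, mul_pos (by linarith : (0 : ℤ) < t) (by linarith : (0 : ℤ) < a),
      mul_pos (by linarith : (0 : ℤ) < a) (by linarith : (0 : ℤ) < a)]
  -- feasibility in `(t, a, P)` alone
  have hFz : 4 * a + 1 + (t + a - 2) * P ≤ (4 * a - 2 * P) * (t + 3 - 2 * a + P) := by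
    have h1 : (4 * a - 2 * P) * g ≤ (4 * a - 2 * P) * (t + 3 - 2 * a + P) :=
      mul_le_mul_of_nonneg_left hgd (by linarith)
    nlinarith [h1, hQ]
  have hH : 2 * a ≤ t + 1 + P := by linarith
  have hid : (g + t - 1 + P) * (g + t - 3 - P) - 2 * (t + 2 - a) - 4 * (g - 1) * a =
      (g + t - 2 - 2 * a) * (g + t - 2 - 2 * a) +
        (4 * a * t - 4 * a * a - 2 * a - 2 * t - 5 - 2 * P - P * P) := by ring
  by_cases hΓ : 0 ≤ 4 * a * t - 4 * a * a - 2 * a - 2 * t - 5 - 2 * P - P * P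
  · nlinarith [hid, hΓ, mul_self_nonneg (g + t - 2 - 2 * a)]
  · push Not at hΓ
    have ht10 := leafC2_t_le_ten t a P ht ha hP hat hw hH hFz hΓ
    have ha7 : a ≤ 7 := by linarith
    have hP13 : P ≤ 13 := by linarith
    interval_cases t <;> interval_cases a <;> interval_cases P <;>
      first
      | (exfalso; omega)
      | nlinarith [hid, hQ, hg, mul_self_nonneg (g + 5 - 2 - 2 * a)]

/-- **THE KEY INEQUALITY, UNIFORMLY** (`t ≥ 5`, maximum degree `d = t + 2 − a` with `1 ≤ a ≤ t − 3`, `g ≥ 1`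
non-neighbours, `T ≤ d` matching pairs, maximum off-degree `δ ≤ d`): the defect sum `Y ≥ 4(m′ − δ)(δ − 2)` and
the split sum `Y ≥ (t − 1)T + (2m′ − T)(m′ + 1 − 2δ)` (`m′ = g + t`) give `2T + 4(g − 1)a ≤ Y`. -/
theorem key_arith (t a g δ T Y : ℕ) (ht : 5 ≤ t) (ha : 1 ≤ a) (hat : a + 3 ≤ t) (hg : 1 ≤ g)
    (hT : T + a ≤ t + 2) (hδ : δ + a ≤ t + 2)
    (hDS : 4 * ((g + t - δ) * (δ - 2)) ≤ Y)
    (hSS : T * (t - 1) + (2 * (g + t) - T) * (g + t + 1 - 2 * δ) ≤ Y) :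
    2 * T + 4 * ((g - 1) * a) ≤ Y := by
  rcases Nat.lt_or_ge g 2 with hg1 | hg2
  · -- `g = 1`: nothing to prove beyond `Y ≥ 2T`
    have hg1' : g = 1 := by omega
    subst hg1'
    have h := two_mul_le_of_split t T Y _ (by omega) hSS
    simp only [Nat.sub_self, zero_mul, mul_zero, add_zero]
    exact h
  · by_cases hδ3 : δ ≤ 3
    · exact leafA_arith t a g δ T Y ht hat hg2 hT hδ3 hSS
    · push Not at hδ3
      by_cases hS1 : 4 * ((g - 1) * a) ≤ (2 * (g + t) - (t + 2 - a)) * (g + t + 1 - 2 * δ)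
      · exact leafB_arith t a g δ T Y ht hT hS1 hSS
      · push Not at hS1
        have hD1 : 2 * (t + 2 - a) + 4 * ((g - 1) * a) ≤ 4 * ((g + t - δ) * (δ - 2)) := by
          by_cases hP : g + t + 1 ≤ 2 * δ
          · -- leaf C1
            obtain ⟨x, rfl⟩ : ∃ x, δ = 4 + x := ⟨δ - 4, by omega⟩
            obtain ⟨y, hy⟩ : ∃ y, t + 2 - a = 4 + x + y := ⟨t + 2 - a - (4 + x), by omega⟩
            obtain ⟨a', rfl⟩ : ∃ a', a = 1 + a' := ⟨a - 1, by omega⟩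
            obtain ⟨h, rfl⟩ : ∃ h, g = 2 + h := ⟨g - 2, by omega⟩
            have ht' : t = 3 + x + y + a' := by omega
            subst ht'
            have hC1 := leafC1_arith x y a' h (by omega) (by omega)
            have e1 : 2 + h + (3 + x + y + a') - (4 + x) = 1 + h + y + a' := by omega
            have e2 : 4 + x - 2 = 2 + x := by omega
            have e3 : 2 + h - 1 = 1 + h := by omega
            rw [e1, e2, e3, hy]
            exact hC1
          · -- leaf C2, in the integers with `P = m′ + 1 − 2δ ≥ 1`
            push Not at hP
            have h2δ : 2 * δ ≤ g + t + 1 := by omega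
            have hδm : δ ≤ g + t := by omega
            have hδ2 : 2 ≤ δ := by omega
            have hat2 : a ≤ t + 2 := by omega
            have hd2 : t + 2 - a ≤ 2 * (g + t) := by omega
            have hQ : ((2 * g + t + a - 2 : ℤ)) * ((g : ℤ) + t + 1 - 2 * δ) + 1 ≤ 4 * ((g : ℤ) - 1) * a := by
              zify [h2δ, hat2, hd2, hg] at hS1
              linarith
            have hC2 := leafC2_arith t a g ((g : ℤ) + t + 1 - 2 * δ) (by exact_mod_cast ht)
              (by exact_mod_cast ha) (by exact_mod_cast hat) (by exact_mod_cast hg2) (by omega) (by omega)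
              (by omega) hQ
            zify [hδm, hδ2, hat2, hg]
            nlinarith [hC2]
        omega

/-- **THE FINAL ARITHMETIC:** the packaged count with `|R| = 2(g + t)`, `m = d + g + t` and the key inequality
`2T + 4(g − 1)(t + 2 − d) ≤ Y` (in the integers) give `cherries ≤ C(d + g − 1, 2) + C(t + 1, 2) + t + 1`. -/
theorem final_arith (ch d g t T Y Rc m : ℕ) (hd : 1 ≤ d) (hRc : Rc = 2 * (g + t)) (hm : m = d + g + t)
    (hfin : 2 * (2 * ch + 2 * m) + Rc * d + Y ≤ 2 * (d * d) + 2 * d + 2 * Rc + 2 * T + Rc * m + Rc)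
    (hkey : 2 * (T : ℤ) + 4 * ((g : ℤ) - 1) * ((t : ℤ) + 2 - d) ≤ Y) :
    ch ≤ (d + g - 1).choose 2 + (t + 1).choose 2 + t + 1 := by
  subst hRc hm
  obtain ⟨d', rfl⟩ : ∃ d', d = d' + 1 := ⟨d - 1, by omega⟩
  have e : d' + 1 + g - 1 = d' + g := by omega
  rw [e]
  have hC1 := two_mul_choose_two_add' (d' + g)
  have hC2 := two_mul_choose_two_add' (t + 1)
  zify at hfin hC1 hC2 ⊢
  push_cast at hkey
  nlinarith [hfin, hC1, hC2, hkey]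

end Uniform

end C047

end TriangleCap

end PercRepro
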